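import Summits.SmoothPoincare4.SmoothPoincare4.Theorems.CongruenceShadowsAgkCor6SufficiencyFlowerCapDefs
import HarnessLib

/-!
# Stub `stub_capSets` of line `lp-by-sphere-system-surgery` for crux `AgkCor6Sufficiency`
(item stmt-SmoothPoincare4-10894, routes `CongruenceShadows` / `GroupTrisection`; lead reshape r6b)

**Set-level basics of the capped melon** on the flower surface `Z_g = FlowerModel.flowerSurface g`
(`g = n + 2`), in the vocabulary of `…FlowerCapDefs`:

* the capped slices `capS g k = secS g k \ capU` are closed (`FlowerModel.isClosed_secS` minus the
  open cap region `capU = {‖proj p‖ < 1/4 ∧ 0 < p 2}`);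
* the lower pole `bot g` (the base point) lies in every slice (it is the endpoint of the arc
  `FlowerModel.arcK hg k ⊆ secS g k`, `FlowerModel.range_arcK_subset`) and not in the cap region
  (its height `-√(level g)` is negative), hence in every capped slice;
* removing the cap distributes over the melon cover `FlowerModel.iUnion_secS_eq_flowerSurface`:
  `Z_g \ capU = ⋃_{j ≤ n+1} capS g j` and `⋃_{j ≤ k} capS g j = (⋃_{j ≤ k} secS g j) \ capU`;
* the cap points `capPt` and the truncated arcs `tArcFun` are `g`-periodic in the slice index,
  since the slice rotations are: `Rk g (k + g) = Rk g k` (`ζ_{k+g} = ζ_k ζ_g = ζ_k`,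
  `FlowerModel.ζC_self`).

References: Hatcher, *Algebraic Topology* (2002), §1.2 pp. 50–52 [HatcherAT2002].  No `sorry`.
-/

set_option linter.dupNamespace false

noncomputable section

open Set Function Metric
open scoped Real unitInterval Manifold ContDiff Topology

namespace Summit.SmoothPoincare4.SmoothPoincare4.Cruxes.AgkCor6Sufficiency.LpBySphereSystemSurgery

open Literature.Topology.FourManifolds Literature.Topology.FourManifolds.FlowerModel
open PlanarThickening PlanarDouble
open Literature.AlgebraicTopology.FundamentalGroup Literature.AlgebraicTopology.FundamentalGroup.VanKampen
  Literature.AlgebraicTopology.Homotopy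

namespace FlowerCap

/-! ## Helpers -/

/-- The cap region `capU` is open: `‖proj p‖` and `p 2` are continuous. -/
private theorem isOpen_capU : IsOpen capU :=
  (isOpen_lt (continuous_norm.comp proj.continuous) continuous_const).inter
    (isOpen_lt continuous_const (EuclideanSpace.proj (2 : Fin 3)).continuous)

/-- The lower pole is not in the cap region: its height `-√(level g)` is not positive. -/
private theorem bot_not_mem_capU {g : ℕ} : bot g ∉ capU := by
  rintro ⟨-, h⟩
  have h0 : 0 ≤ Real.sqrt (level g) := Real.sqrt_nonneg _
  simp [bot] at h
  linarith

/-- The lower pole lies in every slice (it is the endpoint of the `k`-th arc). -/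
private theorem bot_mem_secS {g : ℕ} (hg : 2 ≤ g) (k : ℕ) : bot g ∈ secS g k :=
  range_arcK_subset hg k ⟨1, (arcK hg k).target⟩

/-- `ζ_{k+g} = ζ_k`. -/
private theorem ζC_add_self {g : ℕ} (hg : 1 ≤ g) (k : ℕ) : ζC g (k + g) = ζC g k := by
  have h : ζC g (k + g) = ζC g k * ζC g g := by
    apply Subtype.ext
    simp only [coe_ζC, Circle.coe_mul, pow_add]
  rw [h, ζC_self hg, mul_one]

/-- The slice rotations are `g`-periodic in the slice index. -/
private theorem Rk_add_self {g : ℕ} (hg : 1 ≤ g) (k : ℕ) : Rk g (k + g) = Rk g k := by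
  unfold Rk
  rw [ζC_add_self hg]

/-! ## The stub -/

/-- **Set-level basics of the capped melon** (`g = n + 2`): the capped slices are closed, the lower
pole lies in every capped slice and every slice, the cap region is open, removing the cap
distributes over the melon cover and over the partial unions of slices, and the cap points and
truncated arcs are `g`-periodic in the slice index. [cite: HatcherAT2002, §1.2 pp. 50–52] -/
theorem stub_capSets : ∀ {n : ℕ} (hg : 2 ≤ n + 2) (k : ℕ), IsClosed (capS (n + 2) k) ∧
    bot (n + 2) ∈ capS (n + 2) k ∧ bot (n + 2) ∈ secS (n + 2) k ∧ IsOpen capU ∧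
    flowerSurface (n + 2) \ capU = ⋃ j ≤ n + 1, capS (n + 2) j ∧
    (⋃ j ≤ k, capS (n + 2) j) = (⋃ j ≤ k, secS (n + 2) j) \ capU ∧
    capPt hg (k + (n + 2)) = capPt hg k ∧ (∀ t : ℝ, tArcFun hg (k + (n + 2)) t = tArcFun hg k t) := by
  intro n hg k
  have hg1 : 1 ≤ n + 2 := by omega
  refine ⟨(isClosed_secS hg k).sdiff isOpen_capU, ⟨bot_mem_secS hg k, bot_not_mem_capU⟩,
    bot_mem_secS hg k, isOpen_capU, ?_, ?_, ?_, ?_⟩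
  · -- `Z_g \ capU = ⋃ capS`: distribute `\ capU` over the melon cover
    rw [← iUnion_secS_eq_flowerSurface hg]
    simp only [iUnion_sdiff, capS]
  · simp only [iUnion_sdiff, capS]
  · simp only [capPt, Rk_add_self hg1]
  · intro t
    simp only [tArcFun, Rk_add_self hg1]

end FlowerCap

end Summit.SmoothPoincare4.SmoothPoincare4.Cruxes.AgkCor6Sufficiency.LpBySphereSystemSurgery

end
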